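import Literature.NumberTheory.Sieve.HeathBrownMorozClassSingularSeries
import HarnessLib

/-!
# The coprime pairs of a residue class of the box (Heath-Brown–Moroz 2004, (2.29) at `q = 1`)

Pure-proof file in the residue-class ("coset") port of D. R. Heath-Brown, *Primes represented by
`x³ + 2y³`*, Acta Math. 186 (2001), §5, to the class `x ≡ a, y ≡ b (mod d)` of Heath-Brown–Moroz,
Proc. LMS 88 (2004), §2: the term `R = 1` of the class level of distribution, excluded from the
blocks `Q < N(R) ≤ 2Q`, `Q ≥ 1`, of the class Type-I estimate `class_typeI_A` — the class analogue
of `exists_abs_countA_one_sub_sizeA_le` (`HeathBrownCubicFLRemaindersA`):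
`|#𝒜_f − (6η²X²/π²)(ζ(2)/ζ_d(2))d⁻²| ≤ C(d)·X(1 + log X)` for `X ≥ 2`, `0 ≤ η ≤ 1`, where
`#𝒜_f = classCountA X η d a b ⊤` is the number of coprime pairs of the class in `(X, X(1+η)]²`.
Proof: the split `abs_classCountA_sub_mainTerm_le` at `R = 1` with `Δ = D = ⌊X(1+η)⌋` (no middle
range), the class count of a box being a product of two arithmetic progressions
(`card_Ioc_filter_modEq`, `quotient_side_bounds`) for `X/g ≥ max(2, d)` and trivially bounded
otherwise, and `∑_{g ≤ D} 1/g ≤ 1 + log D`.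
Content: `card_Ioc_filter_modEq`, `card_latticeBox_class_eq`, `abs_card_latticeBox_class_sub_le`,
`card_latticeBox_class_le`, **`exists_abs_classCountA_top_sub_le`**.  Constants depend on `d`
only (`16 + 8(d+3)²`).
[cite: HeathBrownMoroz2004, Lemma 2.4 (2.29)] [cite: HeathBrownActa2001, §5 (5.3)–(5.4)]
Search: `lean search 'countA_one_sub_sizeA|classCountA'` — only the `d = 1` count and the class
bricks.
-/

noncomputable section

open NumberField Finset Filter

open scoped Topology ArithmeticFunction.sigma

namespace Literature.NumberTheory.Sieve.CubicSieve

open LFunctions.CubeRootTwoField CubicPrimes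

/-! ### Arithmetic progressions in an interval and in the box -/

/-- The number of `x ∈ (A, M]` with `x ≡ a (mod d)` (`a ≤ A`, `d ≥ 1`) is
`(M − a)/d − (A − a)/d` (integer division): `x = a + dx'`. [cite: HeathBrownMoroz2004, §2 (2.10)] -/
theorem card_Ioc_filter_modEq {d a A M : ℕ} (hd : 0 < d) (haA : a ≤ A) :
    #{x ∈ Ioc A M | x ≡ a [MOD d]} = (M - a) / d - (A - a) / d := by
  rw [← Nat.card_Ioc]
  symm
  refine card_bij (fun x' _ => a + d * x') (fun x' hx' => ?_) (fun x₁ _ x₂ _ h => ?_)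
    (fun x hx => ?_)
  · rw [mem_filter]
    exact (mem_Ioc_modEq_iff (M := M) hd haA (a + d * x')).2 ⟨x', hx', rfl⟩
  · exact Nat.eq_of_mul_eq_mul_left hd (by simpa using h)
  · rw [mem_filter] at hx
    obtain ⟨x', hx', rfl⟩ := (mem_Ioc_modEq_iff (M := M) hd haA x).1 hx
    exact ⟨x', hx', rfl⟩

open scoped Classical in
/-- The class points of the box form a product of two progressions: for `Y ≥ 0`, `a, b ≤ ⌊Y⌋`,
`#{(x,y) ∈ box(Y) : x ≡ a, y ≡ b (d)} = L_a · L_b` with `L_a = (⌊Y(1+η)⌋ − a)/d − (⌊Y⌋ − a)/d`.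
[cite: HeathBrownMoroz2004, §2 (2.10)] -/
theorem card_latticeBox_class_eq {Y η : ℝ} (hY : 0 ≤ Y) {d a b : ℕ} (hd : 0 < d) (ha : a ≤ ⌊Y⌋₊)
    (hb : b ≤ ⌊Y⌋₊) :
    #{xy ∈ latticeBox Y η | xy.1 ≡ a [MOD d] ∧ xy.2 ≡ b [MOD d]} =
      ((⌊Y * (1 + η)⌋₊ - a) / d - (⌊Y⌋₊ - a) / d) *
        ((⌊Y * (1 + η)⌋₊ - b) / d - (⌊Y⌋₊ - b) / d) := by
  rw [latticeBox_eq_product hY, Finset.filter_product (fun x : ℕ => x ≡ a [MOD d])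
    (fun y : ℕ => y ≡ b [MOD d]), card_product, card_Ioc_filter_modEq hd ha,
    card_Ioc_filter_modEq hd hb]

open scoped Classical in
/-- **The class count of a box**: for a reduced class (`a, b < d`), `d ≤ Y`, `2 ≤ Y`, `0 ≤ η ≤ 1`,
`|#{(x,y) ∈ box(Y) : x ≡ a, y ≡ b (d)} − η²Y²/d²| ≤ 6Y` (each side is `ηY/d + O(2)` and `≤ 2Y`,
`quotient_side_bounds`). [cite: HeathBrownMoroz2004, §2 (2.10)] -/
theorem abs_card_latticeBox_class_sub_le {Y η : ℝ} {d a b : ℕ} (hd : 0 < d) (ha : a < d)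
    (hb : b < d) (hdY : (d : ℝ) ≤ Y) (hY2 : 2 ≤ Y) (hη0 : 0 ≤ η) (hη1 : η ≤ 1) :
    |(#{xy ∈ latticeBox Y η | xy.1 ≡ a [MOD d] ∧ xy.2 ≡ b [MOD d]} : ℝ) -
        η ^ 2 * Y ^ 2 / (d : ℝ) ^ 2| ≤ 6 * Y := by
  have hY : 0 ≤ Y := by linarith
  have hdA : d ≤ ⌊Y⌋₊ := Nat.le_floor hdY
  obtain ⟨-, h₁, h₁'⟩ := quotient_side_bounds hd ha hdY hY2 hη0 hη1
  obtain ⟨-, h₂, h₂'⟩ := quotient_side_bounds hd hb hdY hY2 hη0 hη1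
  rw [card_latticeBox_class_eq hY hd (ha.le.trans hdA) (hb.le.trans hdA), Nat.cast_mul]
  set n₁ : ℝ := (((⌊Y * (1 + η)⌋₊ - a) / d - (⌊Y⌋₊ - a) / d : ℕ) : ℝ) with hn₁
  set n₂ : ℝ := (((⌊Y * (1 + η)⌋₊ - b) / d - (⌊Y⌋₊ - b) / d : ℕ) : ℝ) with hn₂
  set m : ℝ := η * Y / d with hm
  have hd0 : (0 : ℝ) < d := by exact_mod_cast hd
  have hm0 : 0 ≤ m := by positivity
  have hmY : m ≤ Y := by
    rw [hm, div_le_iff₀ hd0]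
    have hd1 : (1 : ℝ) ≤ d := by exact_mod_cast hd
    nlinarith
  have hn₁0 : 0 ≤ n₁ := Nat.cast_nonneg _
  have hsq : η ^ 2 * Y ^ 2 / (d : ℝ) ^ 2 = m * m := by rw [hm]; ring
  rw [hsq, show n₁ * n₂ - m * m = n₁ * (n₂ - m) + (n₁ - m) * m by ring]
  calc |n₁ * (n₂ - m) + (n₁ - m) * m| ≤ |n₁ * (n₂ - m)| + |(n₁ - m) * m| := abs_add_le _ _
    _ = n₁ * |n₂ - m| + |n₁ - m| * m := by
        rw [abs_mul, abs_mul, abs_of_nonneg hn₁0, abs_of_nonneg hm0]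
    _ ≤ 2 * Y * 2 + 2 * Y := by
        refine add_le_add (mul_le_mul h₁' h₂ (abs_nonneg _) (by linarith)) ?_
        exact mul_le_mul h₁ hmY hm0 zero_le_two
    _ = 6 * Y := by ring

open scoped Classical in
/-- A trivial bound: `#{(x,y) ∈ box(Y) : x ≡ a, y ≡ b (d)} ≤ #box(Y) ≤ (ηY + 1)²` for `Y, η ≥ 0`.
[cite: HeathBrownMoroz2004, §2 (2.10)] -/
theorem card_latticeBox_class_le {Y η : ℝ} (hY : 0 ≤ Y) (hη : 0 ≤ η) (d a b : ℕ) :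
    (#{xy ∈ latticeBox Y η | xy.1 ≡ a [MOD d] ∧ xy.2 ≡ b [MOD d]} : ℝ) ≤ (η * Y + 1) ^ 2 := by
  have h1 : #{xy ∈ latticeBox Y η | xy.1 ≡ a [MOD d] ∧ xy.2 ≡ b [MOD d]} ≤ #(latticeBox Y η) :=
    card_le_card (filter_subset _ _)
  have h2 : ((⌊Y * (1 + η)⌋₊ - ⌊Y⌋₊ : ℕ) : ℝ) ≤ η * Y + 1 := by
    have hle : ⌊Y⌋₊ ≤ ⌊Y * (1 + η)⌋₊ := Nat.floor_le_floor (by nlinarith)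
    rw [Nat.cast_sub hle]
    have hA := Nat.lt_floor_add_one Y
    have hM := Nat.floor_le (show 0 ≤ Y * (1 + η) by positivity)
    linarith
  calc (#{xy ∈ latticeBox Y η | xy.1 ≡ a [MOD d] ∧ xy.2 ≡ b [MOD d]} : ℝ)
      ≤ #(latticeBox Y η) := by exact_mod_cast h1
    _ = ((⌊Y * (1 + η)⌋₊ - ⌊Y⌋₊ : ℕ) : ℝ) ^ 2 := by rw [card_latticeBox hY]; push_cast; ring
    _ ≤ (η * Y + 1) ^ 2 := pow_le_pow_left₀ (Nat.cast_nonneg _) h2 2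

/-! ### The coprime pairs of the class -/

set_option maxHeartbeats 800000 in
open scoped Classical in
/-- **The number of coprime pairs of an admissible class in the box**: for `d ≥ 1` and a class
`(a, b)` with `(a³ + 2b³, d) = 1` there is `C = 16 + 8(d+3)²` with
`|#𝒜_f − (6η²X²/π²)(ζ(2)/ζ_d(2))d⁻²| ≤ C·X(1 + log X)` for `X ≥ 2`, `0 ≤ η ≤ 1`, where
`#𝒜_f = classCountA X η d a b ⊤` counts the coprime pairs `x ≡ a, y ≡ b (mod d)` of
`(X, X(1+η)]²` — [HBM, (2.29)] at `q = 1` with an explicit error; the remainder `R_1` of the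
Fundamental Lemma for the class sequence.  By `abs_classCountA_sub_mainTerm_le` at `R = 1`,
`Δ = D`: the head terms are `|#{box(X/g) ∩ class g⁻¹(a,b)} − η²X²/(g²d²)| ≤ 6X/g` for
`X/g ≥ max(2,d)` (`abs_card_latticeBox_class_sub_le`) and `≤ 2(d+3)²` otherwise, the series tail is
`4η²X²/(d²D) ≤ 4X`.
[cite: HeathBrownMoroz2004, Lemma 2.4 (2.29)] [cite: HeathBrownActa2001, §5 (5.3)–(5.4)] -/
theorem exists_abs_classCountA_top_sub_le {d a b : ℕ} (hd : 0 < d)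
    (hadm : Nat.Coprime (a ^ 3 + 2 * b ^ 3) d) :
    ∃ C : ℝ, 0 < C ∧ ∀ X η : ℝ, 2 ≤ X → 0 ≤ η → η ≤ 1 →
      |(classCountA X η d a b ⊤ : ℝ) -
          6 * η ^ 2 * X ^ 2 / Real.pi ^ 2 * zetaTwoCorrection d / (d : ℝ) ^ 2| ≤
        C * X * (1 + Real.log X) := by
  refine ⟨16 + 8 * ((d : ℝ) + 3) ^ 2, by positivity, fun X η hX hη0 hη1 => ?_⟩
  have hX0 : 0 < X := by linarith
  have hd0 : (0 : ℝ) < d := by exact_mod_cast hd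
  have hd1 : (1 : ℝ) ≤ d := by exact_mod_cast hd
  set D : ℕ := ⌊X * (1 + η)⌋₊ with hDdef
  have hXη : X ≤ X * (1 + η) := by nlinarith
  have hD2 : 2 ≤ D := Nat.le_floor (by push_cast; linarith)
  have hDpos : 0 < D := by omega
  have hDX : X * (1 + η) - 1 ≤ D := by
    have := Nat.lt_floor_add_one (X * (1 + η)); rw [← hDdef] at this; linarith
  have hD2X : (D : ℝ) ≤ 2 * X := (Nat.floor_le (by positivity)).trans (by nlinarith)
  have hDr : (1 : ℝ) ≤ D := by exact_mod_cast hDpos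
  -- the split at `R = 1`, `Δ = D`
  have h1 : Squarefree (Ideal.absNorm (⊤ : Ideal (𝓞 K))) := by
    rw [Ideal.absNorm_top]; exact squarefree_one
  have hsplit := abs_classCountA_sub_mainTerm_le (a := a) (b := b) hX0.le h1 hd hadm hDpos le_rfl
    (le_of_eq hDdef.symm)
  have hcop1 : Nat.Coprime d (Ideal.absNorm (⊤ : Ideal (𝓞 K))) := by
    rw [Ideal.absNorm_top]; exact Nat.coprime_one_right d
  have hrho : rho₂ (⊤ : Ideal (𝓞 K)) = 1 := by
    rw [rho₂_eq_of_squarefree h1, Ideal.absNorm_top, Nat.primeFactors_one, prod_empty]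
  rw [if_pos hcop1, hrho, Ideal.absNorm_top, Nat.cast_one, mul_one, div_one, Ioc_self, sum_empty,
    add_zero, ArithmeticFunction.sigma_zero_apply, Nat.divisors_one, card_singleton, Nat.cast_one]
    at hsplit
  refine hsplit.trans ?_
  -- the head terms
  have hterm : ∀ g ∈ Icc 1 D,
      |(#{xy ∈ latticeBox (X / g) η | g * xy.1 ≡ a [MOD d] ∧ g * xy.2 ≡ b [MOD d] ∧
          (⊤ : Ideal (𝓞 K)) ∣ Ideal.span {(g : 𝓞 K)} * pairIdeal xy} : ℝ) -
        (if Nat.Coprime g d ∧ Nat.Coprime d 1 then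
          η ^ 2 * X ^ 2 * Ideal.absNorm ((⊤ : Ideal (𝓞 K)) ⊔ Ideal.span {(g : 𝓞 K)}) /
            ((g : ℝ) ^ 2 * (d : ℝ) ^ 2 * 1) else 0)| ≤
        6 * X * (g : ℝ)⁻¹ + 2 * ((d : ℝ) + 3) ^ 2 := by
    intro g hg
    rw [mem_Icc] at hg
    have hg0 : 0 < g := hg.1
    have hg' : (0 : ℝ) < g := by exact_mod_cast hg0
    have hXg0 : 0 ≤ X / g := by positivity
    have h6 : 0 ≤ 6 * X * (g : ℝ)⁻¹ := by positivity
    by_cases hgd : Nat.Coprime g d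
    swap
    · rw [class_term_eq_zero_of_not_coprime hadm hgd, if_neg fun h => hgd h.1, Nat.cast_zero,
        sub_zero, abs_zero]
      positivity
    obtain ⟨a', b', ha', hb', -, hga, hgb⟩ := exists_reduced_class_of_coprime hd hgd hadm
    have hcard : #{xy ∈ latticeBox (X / g) η | g * xy.1 ≡ a [MOD d] ∧ g * xy.2 ≡ b [MOD d] ∧
        (⊤ : Ideal (𝓞 K)) ∣ Ideal.span {(g : 𝓞 K)} * pairIdeal xy} =
        #{xy ∈ latticeBox (X / g) η | xy.1 ≡ a' [MOD d] ∧ xy.2 ≡ b' [MOD d]} := by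
      rw [card_filter_mul_modEq_eq (Y := X / g) (η := η) hga hgb]
      congr 1
      refine filter_congr fun xy _ => ⟨fun h => ⟨h.1, h.2.1⟩, fun h => ⟨h.1, h.2, ?_⟩⟩
      rw [← Ideal.one_eq_top]; exact one_dvd _
    have hmain : (if Nat.Coprime g d ∧ Nat.Coprime d 1 then
        η ^ 2 * X ^ 2 * Ideal.absNorm ((⊤ : Ideal (𝓞 K)) ⊔ Ideal.span {(g : 𝓞 K)}) /
          ((g : ℝ) ^ 2 * (d : ℝ) ^ 2 * 1) else 0) = η ^ 2 * (X / g) ^ 2 / (d : ℝ) ^ 2 := by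
      rw [if_pos ⟨hgd, Nat.coprime_one_right d⟩, top_sup_eq, Ideal.absNorm_top, Nat.cast_one]
      field_simp
    rw [hcard, hmain]
    by_cases hbig : max 2 (d : ℝ) ≤ X / g
    · have h2 : 2 ≤ X / g := le_trans (le_max_left _ _) hbig
      have hdg : (d : ℝ) ≤ X / g := le_trans (le_max_right _ _) hbig
      calc |(#{xy ∈ latticeBox (X / g) η | xy.1 ≡ a' [MOD d] ∧ xy.2 ≡ b' [MOD d]} : ℝ) -
              η ^ 2 * (X / g) ^ 2 / (d : ℝ) ^ 2|
          ≤ 6 * (X / g) := abs_card_latticeBox_class_sub_le hd ha' hb' hdg h2 hη0 hη1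
        _ = 6 * X * (g : ℝ)⁻¹ := by rw [div_eq_mul_inv]; ring
        _ ≤ 6 * X * (g : ℝ)⁻¹ + 2 * ((d : ℝ) + 3) ^ 2 := by nlinarith
    · rw [not_le] at hbig
      have hsmall : X / g < (d : ℝ) + 2 := by
        rcases lt_max_iff.mp hbig with h | h <;> linarith
      have hL := card_latticeBox_class_le hXg0 hη0 d a' b' (Y := X / g)
      have hL' : (#{xy ∈ latticeBox (X / g) η | xy.1 ≡ a' [MOD d] ∧ xy.2 ≡ b' [MOD d]} : ℝ) ≤
          ((d : ℝ) + 3) ^ 2 := by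
        refine hL.trans (pow_le_pow_left₀ (by positivity) ?_ 2)
        nlinarith
      have hM : η ^ 2 * (X / g) ^ 2 / (d : ℝ) ^ 2 ≤ ((d : ℝ) + 3) ^ 2 := by
        have h1d : (1 : ℝ) ≤ (d : ℝ) ^ 2 := one_le_pow₀ hd1
        calc η ^ 2 * (X / g) ^ 2 / (d : ℝ) ^ 2 ≤ η ^ 2 * (X / g) ^ 2 :=
              div_le_self (by positivity) h1d
          _ ≤ 1 * ((d : ℝ) + 3) ^ 2 := by
              refine mul_le_mul (by nlinarith) (pow_le_pow_left₀ hXg0 (by linarith) 2)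
                (by positivity) zero_le_one
          _ = ((d : ℝ) + 3) ^ 2 := one_mul _
      have hM0 : 0 ≤ η ^ 2 * (X / g) ^ 2 / (d : ℝ) ^ 2 := by positivity
      have hL0 : (0 : ℝ) ≤ #{xy ∈ latticeBox (X / g) η | xy.1 ≡ a' [MOD d] ∧ xy.2 ≡ b' [MOD d]} :=
        Nat.cast_nonneg _
      rw [abs_le]
      constructor <;> nlinarith [sq_nonneg ((d : ℝ) + 3)]
  -- summation over `g ≤ D`
  have hharm : ∑ g ∈ Icc 1 D, (g : ℝ)⁻¹ ≤ 1 + Real.log D :=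
    sum_inv_le_one_add_log hDr _ fun g hg =>
      ⟨(mem_Icc.mp hg).1, by exact_mod_cast (mem_Icc.mp hg).2⟩
  have hlogD : Real.log D ≤ Real.log X + 1 := by
    calc Real.log D ≤ Real.log (2 * X) := Real.log_le_log (by linarith) hD2X
      _ = Real.log 2 + Real.log X := Real.log_mul (by norm_num) hX0.ne'
      _ ≤ Real.log X + 1 := by linarith [Real.log_two_lt_d9]
  have hlogX : 0 ≤ Real.log X := Real.log_nonneg (by linarith)
  have hhead : ∑ g ∈ Icc 1 D,
      |(#{xy ∈ latticeBox (X / g) η | g * xy.1 ≡ a [MOD d] ∧ g * xy.2 ≡ b [MOD d] ∧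
          (⊤ : Ideal (𝓞 K)) ∣ Ideal.span {(g : 𝓞 K)} * pairIdeal xy} : ℝ) -
        (if Nat.Coprime g d ∧ Nat.Coprime d 1 then
          η ^ 2 * X ^ 2 * Ideal.absNorm ((⊤ : Ideal (𝓞 K)) ⊔ Ideal.span {(g : 𝓞 K)}) /
            ((g : ℝ) ^ 2 * (d : ℝ) ^ 2 * 1) else 0)| ≤
      6 * X * (2 + Real.log X) + 2 * ((d : ℝ) + 3) ^ 2 * (2 * X) := by
    refine (sum_le_sum hterm).trans ?_
    rw [sum_add_distrib, ← mul_sum, sum_const, Nat.card_Icc, nsmul_eq_mul]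
    simp only [add_tsub_cancel_right]
    have h1 : 6 * X * ∑ g ∈ Icc 1 D, (g : ℝ)⁻¹ ≤ 6 * X * (2 + Real.log X) :=
      mul_le_mul_of_nonneg_left (hharm.trans (by linarith)) (by positivity)
    have h2 : (D : ℝ) * (2 * ((d : ℝ) + 3) ^ 2) ≤ 2 * ((d : ℝ) + 3) ^ 2 * (2 * X) := by
      nlinarith [sq_nonneg ((d : ℝ) + 3)]
    linarith
  -- the series tail
  have htail : η ^ 2 * X ^ 2 / ((d : ℝ) ^ 2 * 1) * (4 * (1 : ℝ) / D) ≤ 4 * X := by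
    have h1d : (1 : ℝ) ≤ (d : ℝ) ^ 2 := one_le_pow₀ hd1
    have hηX1 : η * X ≤ X := by nlinarith
    have hηX2 : η * X ≤ D := by nlinarith
    have hηX : η ^ 2 * X ^ 2 ≤ X * D :=
      calc η ^ 2 * X ^ 2 = (η * X) * (η * X) := by ring
        _ ≤ X * D := mul_le_mul hηX1 hηX2 (by positivity) hX0.le
    calc η ^ 2 * X ^ 2 / ((d : ℝ) ^ 2 * 1) * (4 * (1 : ℝ) / D)
        ≤ η ^ 2 * X ^ 2 * (4 * (1 : ℝ) / D) := by
          refine mul_le_mul_of_nonneg_right ?_ (by positivity)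
          rw [mul_one]; exact div_le_self (by positivity) h1d
      _ = 4 * (η ^ 2 * X ^ 2) / D := by ring
      _ ≤ 4 * (X * D) / D := by gcongr
      _ = 4 * X := by field_simp
  calc _ ≤ 6 * X * (2 + Real.log X) + 2 * ((d : ℝ) + 3) ^ 2 * (2 * X) + 4 * X :=
        add_le_add hhead htail
    _ ≤ (16 + 8 * ((d : ℝ) + 3) ^ 2) * X * (1 + Real.log X) := by
        nlinarith [sq_nonneg ((d : ℝ) + 3), mul_nonneg hX0.le hlogX,
          mul_nonneg (sq_nonneg ((d : ℝ) + 3)) (mul_nonneg hX0.le hlogX)]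

end Literature.NumberTheory.Sieve.CubicSieve

end
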